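import Mathlib.NumberTheory.NumberField.Basic
import Mathlib.NumberTheory.RamificationInertia.Basic
import Mathlib.RingTheory.RamificationInertia.Basic
import Mathlib.RingTheory.Ideal.Int
import Mathlib.Algebra.BigOperators.Finprod
import HarnessLib

/-!
# Local degrees `e · f` above `p` in towers of number fields

Topic `Literature/NumberTheory/NumberFields`; a *proofs* file (theorems only, no definitions, no
named facts).  For a number field `M`, a rational prime `p` and a prime `P` of `𝓞 M` above `p`
(`P ∈ (span {p}).primesOver (𝓞 M)`), the local degree `[M_P : ℚ_p]` is `e(P|p) · f(P|p)`;
throughout we work with the product `P.ramificationIdx ℤ * P.inertiaDeg ℤ` of Mathlib's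
ramification index and inertia degree of `P` over `ℤ`, called the *local degree* `d(P)` of
`P` in the docstrings below.

* `sum_ramificationIdx_mul_inertiaDeg_eq_finrank`: `∑_{P | p} d(P) = [M : ℚ]` (the fundamental
  identity over `ℤ`, Mathlib's `Ideal.sum_ramification_inertia_eq_finrank`), also as a `finsum`;
* `sum_ramificationIdx_mul_inertiaDeg_eq_finrank_of_isMaximal`: the relative identity
  `∑_{𝔓 | P} e(𝔓|P) f(𝔓|P) = [K : k]` for a finite extension `K ⊇ k` and a prime `P` of `𝓞 k`;
* `ramificationIdx_mul_inertiaDeg_int_eq`, `ramificationIdx_mul_inertiaDeg_int_le`: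
  `d(𝔓) = d(P) · e(𝔓|P) f(𝔓|P) ≤ [K : k] · d(P)` for `P = 𝔓 ∩ 𝓞 k`;
* **main** `forall_exists_two_mul_add_lt_finrank_of_algebra`: the condition
  (★) *for every prime `P | p` of `M` there is a prime `P' | p`, `P' ≠ P`, with
  `∑_{P'' ≠ P, P'} [M_{P''} : ℚ_p] > ½ [M : ℚ]`*
  ascends finite extensions: (★) for `k` implies (★) for every number field `K ⊇ k`.  By the
  fundamental identity, (★) is equivalent to `2 (d(P) + d(P')) < [M : ℚ]`
  (`finrank_lt_two_mul_finsum_iff`), the form in which the main theorem is stated;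
  `forall_exists_finrank_lt_two_mul_finsum_of_algebra` is (★) verbatim.

(★) for `M = F⁺` is hypothesis (4) of Allen–Calegari–Caraiani–Gee–Helm–Le Hung–Newton–Scholze–
Taylor–Thorne, §6.5.1 ("for each `v ∈ S_p` … there exists a place `v̄' ≠ v̄` of `F⁺` such that
`v̄' | p` and `∑_{v̄'' ≠ v̄, v̄'} [F⁺_{v̄''} : ℚ_p] > ½ [F⁺ : ℚ]`"), and the main theorem is the
bookkeeping "the following conditions hold by construction: … For each place `w̄ | p` of `E⁺`,
there exists a place `w̄' ≠ w̄` of `E⁺` …" in the proof of their Thm. 6.1.1 (arXiv:1812.09999,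
p. 89): the condition is arranged for `E₀⁺` and inherited by `E⁺ ⊇ E₀⁺`, `E = E₀ · E_a · E_b · E_c`
(proof: for `𝔓 | p` in `K` put `P = 𝔓 ∩ k`, take `P'` from (★) for `k` and any `𝔓' | P'`; then
`d(𝔓) + d(𝔓') ≤ [K : k] (d(P) + d(P'))` and `[K : ℚ] = [K : k] [k : ℚ]`).

## References

* J. Neukirch, *Algebraic Number Theory*, Springer 1999, Ch. I Prop. 8.2 (fundamental identity),
  Ch. II Prop. 6.8 / 8.5 (local degrees `[M_P : ℚ_p] = e f`). [folklore]
* [ACCGHLNSTT2023] P. B. Allen et al., *Potential automorphy over CM fields*, Ann. of Math. 197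
  (2023), §6.5.1 hypothesis (4) and §6.5, proof of Thm. 6.1.1 (pp. 82, 89 of arXiv:1812.09999).
-/

noncomputable section

open NumberField Ideal

namespace Literature.NumberTheory.NumberFields

/-! ## The fundamental identity over `ℚ` -/

section Absolute

variable (M : Type*) [Field M] [NumberField M] (p : ℕ) [Fact p.Prime]

/-- **Fundamental identity** `∑_{P | p} e(P|p) f(P|p) = [M : ℚ]` for a number field `M` and a
rational prime `p` (Neukirch I.8.2). [folklore] -/
theorem sum_ramificationIdx_mul_inertiaDeg_eq_finrank :
    ∑ P : (span {(p : ℤ)} : Ideal ℤ).primesOver (𝓞 M),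
        (P : Ideal (𝓞 M)).ramificationIdx ℤ * (P : Ideal (𝓞 M)).inertiaDeg ℤ =
      Module.finrank ℚ M := by
  rw [Ideal.sum_ramification_inertia_eq_finrank, RingOfIntegers.rank]

/-- The fundamental identity as a `finsum` over the set of primes above `p`. [folklore] -/
theorem finsum_mem_primesOver_ramificationIdx_mul_inertiaDeg_eq_finrank :
    ∑ᶠ P ∈ (span {(p : ℤ)} : Ideal ℤ).primesOver (𝓞 M), P.ramificationIdx ℤ * P.inertiaDeg ℤ =
      Module.finrank ℚ M := by
  rw [← finsum_set_coe_eq_finsum_mem, finsum_eq_sum_of_fintype,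
    sum_ramificationIdx_mul_inertiaDeg_eq_finrank M p]

omit [NumberField M] in
variable {M p} in
/-- A prime of `𝓞 M` above `p` is maximal (`𝓞 M` is integral over `ℤ`). [folklore] -/
theorem isMaximal_of_mem_primesOver_span {P : Ideal (𝓞 M)}
    (hP : P ∈ (span {(p : ℤ)} : Ideal ℤ).primesOver (𝓞 M)) : P.IsMaximal :=
  haveI := hP.1
  haveI := hP.2
  Ideal.IsMaximal.of_liesOver_isMaximal P (span {(p : ℤ)} : Ideal ℤ)

/-- **The two forms of condition (★).**  For distinct primes `P, P' | p` of `M`: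
`∑_{Q | p, Q ≠ P, P'} d(Q) > ½ [M : ℚ]` iff `2 (d(P) + d(P')) < [M : ℚ]`, by the fundamental
identity `d(P) + d(P') + ∑_{Q ≠ P, P'} d(Q) = [M : ℚ]`. [folklore] -/
theorem finrank_lt_two_mul_finsum_iff {P P' : Ideal (𝓞 M)}
    (hP : P ∈ (span {(p : ℤ)} : Ideal ℤ).primesOver (𝓞 M))
    (hP' : P' ∈ (span {(p : ℤ)} : Ideal ℤ).primesOver (𝓞 M)) (hne : P' ≠ P) :
    Module.finrank ℚ M < 2 * ∑ᶠ Q ∈ (span {(p : ℤ)} : Ideal ℤ).primesOver (𝓞 M) \ {P, P'},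
        Q.ramificationIdx ℤ * Q.inertiaDeg ℤ ↔
      2 * (P.ramificationIdx ℤ * P.inertiaDeg ℤ + P'.ramificationIdx ℤ * P'.inertiaDeg ℤ) <
        Module.finrank ℚ M := by
  have hsub : ({P, P'} : Set (Ideal (𝓞 M))) ⊆ (span {(p : ℤ)} : Ideal ℤ).primesOver (𝓞 M) :=
    Set.insert_subset hP (Set.singleton_subset_iff.2 hP')
  have htot := finsum_mem_primesOver_ramificationIdx_mul_inertiaDeg_eq_finrank M p
  rw [← finsum_mem_add_sdiff hsub (Set.toFinite _), finsum_mem_pair hne.symm] at htot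
  omega

end Absolute

/-! ## Relative identities in a tower `ℚ ⊆ k ⊆ K` -/

section Relative

variable (k K : Type*) [Field k] [NumberField k] [Field K] [NumberField K] [Algebra k K]

/-- **Relative fundamental identity** `∑_{𝔓 | P} e(𝔓|P) f(𝔓|P) = [K : k]` for a prime `P` of
`𝓞 k` (Neukirch I.8.2; Mathlib's `Ideal.sum_ramification_inertia` in the currency
`Ideal.ramificationIdx`/`Ideal.inertiaDeg`). [folklore] -/
theorem sum_ramificationIdx_mul_inertiaDeg_eq_finrank_of_isMaximal (P : Ideal (𝓞 k))
    [P.IsMaximal] :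
    ∑ 𝔓 : P.primesOver (𝓞 K),
        (𝔓 : Ideal (𝓞 K)).ramificationIdx (𝓞 k) * (𝔓 : Ideal (𝓞 K)).inertiaDeg (𝓞 k) =
      Module.finrank k K := by
  have hP0 : P ≠ ⊥ := Ring.ne_bot_of_isMaximal_of_not_isField ‹_› (RingOfIntegers.not_isField k)
  rw [← Finset.sum_subtype (F := inferInstance) (IsDedekindDomain.primesOverFinset P (𝓞 K))
      (fun Q => IsDedekindDomain.mem_primesOverFinset_iff hP0 (𝓞 K))
      (fun Q : Ideal (𝓞 K) => Q.ramificationIdx (𝓞 k) * Q.inertiaDeg (𝓞 k))]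
  refine Eq.trans (Finset.sum_congr rfl fun Q hQ => ?_)
    (Ideal.sum_ramification_inertia (𝓞 K) k K hP0)
  obtain ⟨hQp, hQo⟩ := (IsDedekindDomain.mem_primesOverFinset_iff hP0 (𝓞 K)).1 hQ
  haveI := hQp
  haveI := hQo
  haveI : Q.IsMaximal := Ideal.IsMaximal.of_liesOver_isMaximal Q P
  rw [Ideal.ramificationIdx'_eq_ramificationIdx P Q hP0, Ideal.inertiaDeg'_eq_inertiaDeg P Q]

omit [NumberField K] in
/-- **Local degrees are multiplicative in towers**: for a prime `𝔓` of `K` and `P = 𝔓 ∩ 𝓞 k`,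
`e(𝔓|p) f(𝔓|p) = e(P|p) f(P|p) · e(𝔓|P) f(𝔓|P)` (Neukirch II.8.5 / transitivity of `e` and
`f`, Mathlib `Ideal.ramificationIdx_tower`, `Ideal.inertiaDeg_tower`). [folklore] -/
theorem ramificationIdx_mul_inertiaDeg_int_eq (𝔓 : Ideal (𝓞 K)) :
    𝔓.ramificationIdx ℤ * 𝔓.inertiaDeg ℤ =
      (𝔓.under (𝓞 k)).ramificationIdx ℤ * (𝔓.under (𝓞 k)).inertiaDeg ℤ *
        (𝔓.ramificationIdx (𝓞 k) * 𝔓.inertiaDeg (𝓞 k)) := by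
  rw [Ideal.ramificationIdx_tower (R := ℤ) (𝔓.under (𝓞 k)) 𝔓,
    Ideal.inertiaDeg_tower (R := ℤ) (𝔓.under (𝓞 k)) 𝔓]
  ring

/-- `e(𝔓|P) f(𝔓|P) ≤ [K : k]` for a prime `𝔓` of `K` and `P = 𝔓 ∩ 𝓞 k`. [folklore] -/
theorem ramificationIdx_mul_inertiaDeg_le_finrank (𝔓 : Ideal (𝓞 K)) [𝔓.IsMaximal] :
    𝔓.ramificationIdx (𝓞 k) * 𝔓.inertiaDeg (𝓞 k) ≤ Module.finrank k K := by
  rw [← sum_ramificationIdx_mul_inertiaDeg_eq_finrank_of_isMaximal k K (𝔓.under (𝓞 k))]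
  exact Finset.single_le_sum (s := Finset.univ)
    (f := fun Q : (𝔓.under (𝓞 k)).primesOver (𝓞 K) =>
      (Q : Ideal (𝓞 K)).ramificationIdx (𝓞 k) * (Q : Ideal (𝓞 K)).inertiaDeg (𝓞 k))
    (fun _ _ => Nat.zero_le _) (Finset.mem_univ (primesOver.mk (𝔓.under (𝓞 k)) 𝔓))

/-- **`[K_𝔓 : ℚ_p] ≤ [K : k] · [k_P : ℚ_p]`** for `P = 𝔓 ∩ 𝓞 k`:
`d(𝔓) ≤ [K : k] · d(P)`. [folklore] -/
theorem ramificationIdx_mul_inertiaDeg_int_le (𝔓 : Ideal (𝓞 K)) [𝔓.IsMaximal] :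
    𝔓.ramificationIdx ℤ * 𝔓.inertiaDeg ℤ ≤
      Module.finrank k K *
        ((𝔓.under (𝓞 k)).ramificationIdx ℤ * (𝔓.under (𝓞 k)).inertiaDeg ℤ) := by
  rw [ramificationIdx_mul_inertiaDeg_int_eq k K 𝔓, mul_comm (Module.finrank k K)]
  exact Nat.mul_le_mul_left _ (ramificationIdx_mul_inertiaDeg_le_finrank k K 𝔓)

/-! ## Condition (★) ascends finite extensions -/

/-- **Condition (★) ascends finite extensions** (compact form).  Let `K ⊇ k` be number fields
and `p` a prime.  If for every prime `P | p` of `k` there is a prime `P' | p`, `P' ≠ P`, with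
`2 (d(P) + d(P')) < [k : ℚ]` (`d` = local degree `e f` over `ℚ_p`), then the same holds for
`K`: given `𝔓 | p` in `K`, let `P = 𝔓 ∩ 𝓞 k`, take `P'` as in the hypothesis and any prime
`𝔓'` of `K` above `P'`; then `𝔓' ≠ 𝔓` and
`2 (d(𝔓) + d(𝔓')) ≤ [K : k] · 2 (d(P) + d(P')) < [K : k] [k : ℚ] = [K : ℚ]`.  This is the
inheritance of hypothesis (4) of ACC+ §6.5.1 from `E₀⁺` to `E⁺` in the proof of Thm. 6.1.1.
[cite: ACCGHLNSTT2023, §6.5, proof of Thm. 6.1.1 (p. 89 of arXiv:1812.09999)] -/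
theorem forall_exists_two_mul_add_lt_finrank_of_algebra (p : ℕ) [Fact p.Prime]
    (h : ∀ P ∈ (span {(p : ℤ)} : Ideal ℤ).primesOver (𝓞 k),
      ∃ P' ∈ (span {(p : ℤ)} : Ideal ℤ).primesOver (𝓞 k), P' ≠ P ∧
        2 * (P.ramificationIdx ℤ * P.inertiaDeg ℤ + P'.ramificationIdx ℤ * P'.inertiaDeg ℤ) <
          Module.finrank ℚ k) :
    ∀ 𝔓 ∈ (span {(p : ℤ)} : Ideal ℤ).primesOver (𝓞 K),
      ∃ 𝔓' ∈ (span {(p : ℤ)} : Ideal ℤ).primesOver (𝓞 K), 𝔓' ≠ 𝔓 ∧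
        2 * (𝔓.ramificationIdx ℤ * 𝔓.inertiaDeg ℤ + 𝔓'.ramificationIdx ℤ * 𝔓'.inertiaDeg ℤ) <
          Module.finrank ℚ K := by
  intro 𝔓 h𝔓
  haveI := h𝔓.1
  haveI := h𝔓.2
  haveI : 𝔓.IsMaximal := isMaximal_of_mem_primesOver_span h𝔓
  -- `P = 𝔓 ∩ 𝓞 k` is a prime of `k` above `p`
  have hP : 𝔓.under (𝓞 k) ∈ (span {(p : ℤ)} : Ideal ℤ).primesOver (𝓞 k) :=
    ⟨inferInstance, inferInstance⟩
  obtain ⟨P', hP', hP'ne, hlt⟩ := h _ hP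
  haveI := hP'.1
  haveI := hP'.2
  haveI : P'.IsMaximal := isMaximal_of_mem_primesOver_span hP'
  -- a prime `𝔓'` of `K` above `P'`
  haveI : FaithfulSMul (𝓞 k) (𝓞 K) :=
    (faithfulSMul_iff_algebraMap_injective (𝓞 k) (𝓞 K)).2 (RingOfIntegers.algebraMap.injective k K)
  obtain ⟨𝔓', h𝔓'max, h𝔓'over⟩ :=
    Ideal.exists_maximal_ideal_liesOver_of_isIntegral (S := 𝓞 K) P'
  haveI := h𝔓'max
  haveI := h𝔓'over
  have h𝔓'p : 𝔓'.LiesOver (span {(p : ℤ)} : Ideal ℤ) := Ideal.LiesOver.trans 𝔓' P' _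
  refine ⟨𝔓', ⟨h𝔓'max.isPrime, h𝔓'p⟩, fun heq => hP'ne ?_, ?_⟩
  · rw [Ideal.over_def 𝔓' P', heq]
  · have h1 := ramificationIdx_mul_inertiaDeg_int_le k K 𝔓
    have h2 := ramificationIdx_mul_inertiaDeg_int_le k K 𝔓'
    rw [← Ideal.over_def 𝔓' P'] at h2
    have hKk : 0 < Module.finrank k K := Module.finrank_pos
    rw [← Module.finrank_mul_finrank ℚ k K]
    calc 2 * (𝔓.ramificationIdx ℤ * 𝔓.inertiaDeg ℤ + 𝔓'.ramificationIdx ℤ * 𝔓'.inertiaDeg ℤ)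
        ≤ 2 * (Module.finrank k K * ((𝔓.under (𝓞 k)).ramificationIdx ℤ *
              (𝔓.under (𝓞 k)).inertiaDeg ℤ) +
            Module.finrank k K * (P'.ramificationIdx ℤ * P'.inertiaDeg ℤ)) :=
          Nat.mul_le_mul_left 2 (add_le_add h1 h2)
      _ = Module.finrank k K * (2 * ((𝔓.under (𝓞 k)).ramificationIdx ℤ *
              (𝔓.under (𝓞 k)).inertiaDeg ℤ + P'.ramificationIdx ℤ * P'.inertiaDeg ℤ)) := by
          ring
      _ < Module.finrank k K * Module.finrank ℚ k := (Nat.mul_lt_mul_left hKk).2 hlt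
      _ = Module.finrank ℚ k * Module.finrank k K := mul_comm _ _

/-- **Condition (★) ascends finite extensions** (the printed form, with the sum over the
remaining primes): if for every `P | p` of `k` there is `P' | p`, `P' ≠ P`, with
`∑_{P'' ≠ P, P'} [k_{P''} : ℚ_p] > ½ [k : ℚ]`, then the same holds for every number field
`K ⊇ k` — hypothesis (4) of ACC+ §6.5.1 passes from `E₀⁺` to `E⁺`.
[cite: ACCGHLNSTT2023, §6.5.1 (4) and §6.5, proof of Thm. 6.1.1 (pp. 82, 89 of
arXiv:1812.09999)] -/
theorem forall_exists_finrank_lt_two_mul_finsum_of_algebra (p : ℕ) [Fact p.Prime]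
    (h : ∀ P ∈ (span {(p : ℤ)} : Ideal ℤ).primesOver (𝓞 k),
      ∃ P' ∈ (span {(p : ℤ)} : Ideal ℤ).primesOver (𝓞 k), P' ≠ P ∧
        Module.finrank ℚ k < 2 * ∑ᶠ Q ∈ (span {(p : ℤ)} : Ideal ℤ).primesOver (𝓞 k) \ {P, P'},
          Q.ramificationIdx ℤ * Q.inertiaDeg ℤ) :
    ∀ 𝔓 ∈ (span {(p : ℤ)} : Ideal ℤ).primesOver (𝓞 K),
      ∃ 𝔓' ∈ (span {(p : ℤ)} : Ideal ℤ).primesOver (𝓞 K), 𝔓' ≠ 𝔓 ∧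
        Module.finrank ℚ K < 2 * ∑ᶠ Q ∈ (span {(p : ℤ)} : Ideal ℤ).primesOver (𝓞 K) \ {𝔓, 𝔓'},
          Q.ramificationIdx ℤ * Q.inertiaDeg ℤ := by
  intro 𝔓 h𝔓
  obtain ⟨𝔓', h𝔓', hne, hlt⟩ := forall_exists_two_mul_add_lt_finrank_of_algebra k K p
    (fun P hP => by
      obtain ⟨P', hP', hne, hlt⟩ := h P hP
      exact ⟨P', hP', hne, (finrank_lt_two_mul_finsum_iff k p hP hP' hne).1 hlt⟩) 𝔓 h𝔓
  exact ⟨𝔓', h𝔓', hne, (finrank_lt_two_mul_finsum_iff K p h𝔓 h𝔓' hne).2 hlt⟩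

end Relative

end Literature.NumberTheory.NumberFields

end
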